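import Mathlib
import HarnessLib
import Summits.QuantumFields.Statement
import Summits.QuantumFields.QCD.Theses.PauliWegnerSea

/-!
# Sketch — crux idea `shoot-the-bare-mass` for crux stmt-QuantumFields-11513
(`Summit.QuantumFields.QCD.Theses.PauliWegnerSea.OneScaleTrajectory`)

Lever: the witness `reg` is DEFINED by the clauses — `a_k` arbitrary, `β_k := afBeta N_f 1 a_k`,
`Z_m(k) := (log a_k⁻²)^{γ₀/2β₀}` by fiat (BOOK), `mcrit(k) :=` the infimum of the bare masses above
which a fixed-constant decay certificate holds (SHOOTING), `L_k` any super-log volume. Then the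
one-scale clause for ALL mass tuples is ORDER (MONO), and the residual content of the crux is the
fixed-coupling window statement (RANGE ∧ LOWER-WINDOW) plus sign-defect extinction without rate.
-/

noncomputable section

namespace Summit.QuantumFields.QCD.Cruxes.OneScaleTrajectory.ShootTheBareMass

open MeasureTheory Filter Topology
open Literature.MathematicalPhysics.QuantumFieldTheory Literature.MathematicalPhysics.QuantumLattice
  Literature.Probability.LatticeModels

/-- FIRST LEMMA (BOOK, provable now — proved below): the `∃ reg` prefix of `OneScaleTrajectory` is
inhabited with ARBITRARY spacings `a_k ↓ 0`, ARBITRARY critical masses and ARBITRARY volumes with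
`a_k L_k → ∞`; `β_k := afBeta N_f 1 a_k` and the fiat `Z_m` discharge `HasAsymptoticScaling` and
`HasMassScaling`. Asymptotic scaling is bookkeeping: no clause of the crux ties `a_k` to physics
except through the rates it must then exhibit. -/
def Bookkeeping : Prop :=
  ∀ (Nf : ℕ) (a mc : ℕ → ℝ) (L : ℕ → ℕ), (∀ k, 0 < a k) → Tendsto a atTop (𝓝 0) →
    Tendsto (fun k => a k * (L k : ℝ)) atTop atTop →
      ∃ reg : QCDRegularisation Nf, reg.a = a ∧ reg.mcrit = mc ∧ reg.L = L ∧
        reg.HasMassScaling ∧ (reg.scheme 0 0 0).HasAsymptoticScaling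

theorem bookkeeping_holds : Bookkeeping := by
  intro Nf a mc L ha ha0 hL
  classical
  have hlog : ∀ k, a k < 1 → 0 < Real.log (1 / a k ^ 2) ^ massExponent Nf := by
    intro k hk
    apply Real.rpow_pos_of_pos
    apply Real.log_pos
    have hak := ha k
    have h2 : a k ^ 2 < 1 := by nlinarith
    exact one_lt_one_div (by positivity) h2
  refine ⟨{ a := a, a_pos := ha, tendsto_a := ha0, β := fun k => afBeta Nf 1 (a k), L := L,
            tendsto_L := hL, mcrit := mc,
            Zm := fun k => if a k < 1 then Real.log (1 / a k ^ 2) ^ massExponent Nf else 1,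
            Zm_pos := ?_ }, rfl, rfl, rfl, ?_, ?_⟩
  · intro k
    show 0 < (if a k < 1 then Real.log (1 / a k ^ 2) ^ massExponent Nf else 1)
    split_ifs with hk
    · exact hlog k hk
    · exact one_pos
  · refine ⟨1, one_pos, tendsto_const_nhds.congr' ?_⟩
    have hev : ∀ᶠ k in atTop, a k < 1 := ha0.eventually (gt_mem_nhds one_pos)
    filter_upwards [hev] with k hk
    show (1 : ℝ) = (if a k < 1 then Real.log (1 / a k ^ 2) ^ massExponent Nf else 1) /
      Real.log (1 / a k ^ 2) ^ massExponent Nf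
    rw [if_pos hk, div_self (hlog k hk).ne']
  · refine ⟨1, one_pos, ?_⟩
    simp [QCDRegularisation.scheme]

/-- SHOOTING ORDER LEMMA (pure real analysis): an upward-closed certificate on the bare-mass axis
that holds somewhere and fails somewhere above `lo` has a threshold `m⋆ > lo` above which it holds
and below which it fails (`m⋆ = sInf`). Applied at each `k` it DEFINES `mcrit(k)`. -/
def ShootingOrder : Prop :=
  ∀ (P : ℝ → Prop) (lo : ℝ), (∀ x y, x ≤ y → P x → P y) → (∃ x, lo < x ∧ ¬ P x) → (∃ y, P y) →
    ∃ m : ℝ, lo < m ∧ (∀ y, m < y → P y) ∧ (∀ x, x < m → ¬ P x)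

/-- The phase-quenched fractional moment of the flavour-`f` quark propagator from `0` to `v` on the
torus of side `2S+1` at inverse coupling `β` and bare masses `mq` — verbatim the quantity of the
one-scale clause and of clause (iii) of `OneScaleTrajectory`, with `(β, mq)` free. -/
def fm (Nf : ℕ) (β : ℝ) (mq : Fin Nf → ℝ) (S : ℕ) (f : Fin Nf) (v : Site 4) (s : ℝ) : ℝ :=
  (∫ U : GaugeConfig 4 (2 * S + 1) (Matrix.specialUnitaryGroup (Fin 3) ℂ),
      ‖(diracMatrix U mq).det‖ *
        (∑ a : Fin 3, ∑ i : Fin 4, ∑ b : Fin 3, ∑ j : Fin 4,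
          ‖(diracMatrix U mq)⁻¹ (quarkEquiv (f, (Torus.proj (2 * S + 1) 0, a, i)))
            (quarkEquiv (f, (Torus.proj (2 * S + 1) v, b, j)))‖) ^ s
      ∂(wilsonMeasure (fundamentalRep (Fin 3)) β)) /
    (∫ U : GaugeConfig 4 (2 * S + 1) (Matrix.specialUnitaryGroup (Fin 3) ℂ),
      ‖(diracMatrix U mq).det‖ ∂(wilsonMeasure (fundamentalRep (Fin 3)) β))

/-- MONO (the order input; fixed coupling; an association inequality — the fractional-moment twin of
`QuarkMassMonotone.LatticeGapMonotone`): raising the bare Wilson masses componentwise (valence AND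
sea) never increases the phase-quenched fractional moment of any quark propagator, at every
`β ≥ 0`, volume, flavour, separation and exponent, on the physical branch `mq > -1`. -/
def FMMonotone : Prop :=
  ∀ (Nf : ℕ) (β : ℝ), 0 ≤ β → ∀ (mq mq' : Fin Nf → ℝ), (∀ f, -1 < mq f) → (∀ f, mq f ≤ mq' f) →
    ∀ (S : ℕ) (f : Fin Nf) (v : Site 4) (s : ℝ), 0 < s → s < 1 →
      fm Nf β mq' S f v s ≤ fm Nf β mq S f v s

/-- The reference CERTIFICATE shot on: physical-rate exponential decay, with FIXED constants
`(s, p, μ) = (1/2, p, μ)`, of the DEGENERATE-tuple fractional moment beyond the first log shell,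
uniformly in all volumes `S ≥ L_k`, at coupling `afBeta N_f 1 a_k` and flavour-blind bare mass `m₀`.
Under `FMMonotone` it is upward closed in `m₀`; at lattice-heavy `m₀ = 1` it holds for every gauge
field (unitary hopping, Neumann bound); the statement `RangeRef` says it fails somewhere above `-1`. -/
def Cert (Nf p : ℕ) (μ : ℝ) (a : ℕ → ℝ) (L : ℕ → ℕ) (k : ℕ) (m₀ : ℝ) : Prop :=
  ∀ S : ℕ, L k ≤ S → ∀ (f : Fin Nf) (v : Site 4), v ∈ box 4 S →
    1 + |Real.log (a k)| ≤ a k * ‖v‖ →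
      fm Nf (afBeta Nf 1 (a k)) (fun _ => m₀) S f v (1 / 2) ≤
        (1 / a k) ^ p * Real.exp (-(μ * (a k * ‖v‖)))

/-- The SHOT critical mass: the infimum of the bare masses above which the certificate holds. -/
def critMass (Nf p : ℕ) (μ : ℝ) (a : ℕ → ℝ) (L : ℕ → ℕ) (k : ℕ) : ℝ :=
  sInf {x : ℝ | ∀ y : ℝ, x ≤ y → Cert Nf p μ a L k y}

/-- RANGE (reference form; the irreducible infrared kernel — "light hadrons exist somewhere on the
bare-mass axis at every large coupling"): eventually in `k` the certificate fails at some bare mass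
above `-1` (and holds at some bare mass, e.g. the lattice-heavy `m₀ = 1`). -/
def RangeRef (Nf p : ℕ) (μ : ℝ) (a : ℕ → ℝ) (L : ℕ → ℕ) : Prop :=
  ∀ᶠ k in atTop, (∃ x : ℝ, -1 < x ∧ ¬ Cert Nf p μ a L k x) ∧ (∃ y : ℝ, ∀ y', y ≤ y' → Cert Nf p μ a L k y')

/-- LOWER WINDOW (= NOJUMP; the irreducible ultraviolet kernel, ONE-SIDED: the bare-to-physical
mass conversion at the shot point grows no faster than the leading log `Z_m(k)`): for every `M`,
the clause-(iii) lower bound holds, with `M`-dependent constants, for the degenerate tuple at every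
bare mass in the window `(critMass k, critMass k + a_k M / Z_m(k)]`, in all volumes `S ≥ L_k`. -/
def LowerWindow (Nf p : ℕ) (μ : ℝ) (a : ℕ → ℝ) (L : ℕ → ℕ) : Prop :=
  ∀ M : ℝ, 0 < M → ∃ s c₀ C₁ q : ℝ, 0 < s ∧ s < 1 ∧ 0 < c₀ ∧ ∀ᶠ k in atTop,
    ∀ m₀ : ℝ, critMass Nf p μ a L k < m₀ →
      m₀ ≤ critMass Nf p μ a L k + a k * M / Real.log (1 / a k ^ 2) ^ massExponent Nf →
        ∀ S : ℕ, L k ≤ S → ∀ (f : Fin Nf) (n : ℕ), n ≤ S →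
          c₀ * Real.exp (-(C₁ * (a k * n) + q * Real.log (n + 1))) ≤
            fm Nf (afBeta Nf 1 (a k)) (fun _ => m₀) S f (Pi.single 0 (n : ℤ)) s

/-- EXTINCTION-LITE (clause (iv) for the shot witness, no rate): sign coherence of the signed
Wilson sea at the scheme's own side `2L_k+1` along the shot trajectory, for every mass tuple —
with `L_k` merely super-logarithmic this needs only "density of sign defects per physical volume
→ 0 faster than `1/log⁴(1/a_k)`", not the `a_k^{(3-N_f)/(4b₀)-s_d}` rate of WindowExtinction. -/
def SignLite (Nf p : ℕ) (μ : ℝ) (a : ℕ → ℝ) (L : ℕ → ℕ) : Prop :=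
  ∀ m : Fin Nf → ℝ, (∀ f, 0 < m f) → ∀ᶠ k in atTop,
    (1 / 2 : ℝ) ≤
      ‖∫ U : GaugeConfig 4 (2 * L k + 1) (Matrix.specialUnitaryGroup (Fin 3) ℂ),
          (diracMatrix U fun fl => critMass Nf p μ a L k +
              a k * m fl / Real.log (1 / a k ^ 2) ^ massExponent Nf).det
          ∂(wilsonMeasure (fundamentalRep (Fin 3)) (afBeta Nf 1 (a k)))‖ /
        (∫ U : GaugeConfig 4 (2 * L k + 1) (Matrix.specialUnitaryGroup (Fin 3) ℂ),
          ‖(diracMatrix U fun fl => critMass Nf p μ a L k +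
              a k * m fl / Real.log (1 / a k ^ 2) ^ massExponent Nf).det‖
          ∂(wilsonMeasure (fundamentalRep (Fin 3)) (afBeta Nf 1 (a k))))

/-- MONO-FREE VARIANT of the certificate: quantify over all mass TUPLES whose lightest bare mass is
at least `m₀` (upward closure in `m₀` is then automatic, no association inequality needed). -/
def CertBox (Nf p : ℕ) (μ : ℝ) (a : ℕ → ℝ) (L : ℕ → ℕ) (k : ℕ) (m₀ : ℝ) : Prop :=
  ∀ mq : Fin Nf → ℝ, (∀ f, m₀ ≤ mq f) → ∀ S : ℕ, L k ≤ S → ∀ (f : Fin Nf) (v : Site 4), v ∈ box 4 S →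
    1 + |Real.log (a k)| ≤ a k * ‖v‖ →
      fm Nf (afBeta Nf 1 (a k)) mq S f v (1 / 2) ≤ (1 / a k) ^ p * Real.exp (-(μ * (a k * ‖v‖)))

/-- Its shot threshold. -/
def critMassBox (Nf p : ℕ) (μ : ℝ) (a : ℕ → ℝ) (L : ℕ → ℕ) (k : ℕ) : ℝ :=
  sInf {x : ℝ | CertBox Nf p μ a L k x}

/-- MONO-FREE lower window: clause-(iii) bound for every tuple inside the bare box
`(critMassBox k, critMassBox k + a_k M / Z_m(k)]^{N_f}`. With `CertBox`/`LowerWindowBox` in place of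
`Cert`/`LowerWindow` the transfer to the crux is pure logic (no `FMMonotone`). -/
def LowerWindowBox (Nf p : ℕ) (μ : ℝ) (a : ℕ → ℝ) (L : ℕ → ℕ) : Prop :=
  ∀ M : ℝ, 0 < M → ∃ s c₀ C₁ q : ℝ, 0 < s ∧ s < 1 ∧ 0 < c₀ ∧ ∀ᶠ k in atTop,
    ∀ mq : Fin Nf → ℝ, (∀ f, critMassBox Nf p μ a L k < mq f) →
      (∀ f, mq f ≤ critMassBox Nf p μ a L k + a k * M / Real.log (1 / a k ^ 2) ^ massExponent Nf) →
        ∀ S : ℕ, L k ≤ S → ∀ (f : Fin Nf) (n : ℕ), n ≤ S →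
          c₀ * Real.exp (-(C₁ * (a k * n) + q * Real.log (n + 1))) ≤
            fm Nf (afBeta Nf 1 (a k)) mq S f (Pi.single 0 (n : ℤ)) s

/-- TRANSFER TARGET `C⁺ → C` (the shape a crux-plan skeleton would certify; conclusion = the crux
BY NAME). `C⁺` is EASIER than `C`: no datum of the witness is constructed (all are free or shot),
asymptotic scaling is never proved (BOOK), the ∀m quantifier is discharged by ORDER between two
degenerate tuples (MONO, used upward for the one-scale clause and downward for (iii)), and what is
left are one fixed-coupling infrared existence statement (RangeRef), one ONE-SIDED ultraviolet
response statement (LowerWindow) and sign extinction without rate (SignLite). -/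
def TransferTarget : Prop :=
  Bookkeeping → FMMonotone →
    (∀ Nf : ℕ, Nf = 2 ∨ Nf = 3 → ∃ (p : ℕ) (μ : ℝ) (a : ℕ → ℝ) (L : ℕ → ℕ),
        0 < μ ∧ (∀ k, 0 < a k) ∧ (∀ k, a k < 1) ∧ Tendsto a atTop (𝓝 0) ∧
          Tendsto (fun k => a k * (L k : ℝ) / (1 + |Real.log (a k)|) ^ 2) atTop atTop ∧
            RangeRef Nf p μ a L ∧ LowerWindow Nf p μ a L ∧ SignLite Nf p μ a L) →
      Summit.QuantumFields.QCD.Theses.PauliWegnerSea.OneScaleTrajectory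

end Summit.QuantumFields.QCD.Cruxes.OneScaleTrajectory.ShootTheBareMass

end
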